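import Summits.CriticalPhenomena.SAWScalingLimit.Theses.SAWTwistedSelfEnergy
import Literature.Probability.RandomPlanarGeometry.TwistedLaceExpansionIdentity

/-!
# Strategist sketch for crux `TwistedKernelTailIndex` (stmt-CriticalPhenomena-17873)

Signatures used by `STRATEGY-CENSUS.md` (crux-strategist, 2026-08-17): the REPAIRED (first-step) crux, its
clean lace form, the typed split of the crux AS TYPED (mixed convention) into identification / lace upper /
correction upper / kernel lower, the strengthened form `S⁺`, the typed negation obstruction, and the
provable-now link `TwistedKernelTailIndex → TwistedKernelSummable`.
-/

noncomputable section

open scoped BigOperators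
open Literature.Probability.LatticeModels
open Literature.Probability.RandomPlanarGeometry.LaceExpansion
open Literature.Probability.RandomPlanarGeometry.SAW (criticalFugacity)

namespace Summit.CriticalPhenomena.SAWScalingLimit.Cruxes.TwistedKernelTailIndex.Strategist

/-! ### 0. Shorthand -/

/-- `x_c = 1/μ(ℤ²)`. -/
abbrev xc : ℝ := criticalFugacity

/-- Entrywise `ℓ¹` norm of a `4 × 4` complex matrix (the crux's inner double sum). -/
def absM (M : Matrix (Fin 4) (Fin 4) ℂ) : ℝ := ∑ ι : Fin 4, ∑ κ : Fin 4, ‖M ι κ‖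

/-- The `n`-resolved absolute `s`-moment summand `x_c^n |z|^s ‖F_n(z)‖₁` of a kernel `F` on `ℕ × ℤ²`. -/
def moment (F : ℕ → Site 2 → Matrix (Fin 4) (Fin 4) ℂ) (s : ℝ) : ℕ × Site 2 → ℝ :=
  fun p => xc ^ p.1 * ‖Site.toComplex p.2‖ ^ s * absM (F p.1 p.2)

/-- "`F` has moment abscissa exactly `a`": finite `s`-moments for `0 ≤ s < a`, infinite for `s > a`. -/
def HasMomentAbscissa (F : ℕ → Site 2 → Matrix (Fin 4) (Fin 4) ℂ) (a : ℝ) : Prop :=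
  (∀ s : ℝ, 0 ≤ s → s < a → Summable (moment F s)) ∧ (∀ s : ℝ, a < s → ¬ Summable (moment F s))

/-! ### 1. The item's vocabulary, named (letter for letter, as in the sibling line `TwistedKernelSummable/Lines/birth.lean`) -/

/-- The item's step matrix `T` (`σ = 5/8`). -/
def mixedT : Matrix (Fin 4) (Fin 4) ℂ := fun a b =>
  if stepDir b = -stepDir a then 0 else
    Complex.exp (-Complex.I * (5 / 8 : ℝ) *
      (turning (-Site.toComplex (stepDir a)) 0 (Site.toComplex (stepDir b)) : ℝ))

/-- The item's twisted two-point matrix `G n z`. -/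
def mixedG : ℕ → Site 2 → Matrix (Fin 4) (Fin 4) ℂ := fun n z ι κ =>
  if n = 0 then (if z = 0 ∧ ι = κ then 1 else 0) else
    ∑ p ∈ ((zdGraph 2).finsetWalkLength n (0 : Site 2) z).filter (fun p => p.IsPath),
      (if p.getVert 1 = -stepDir ι ∨ z - p.getVert (n - 1) ≠ stepDir κ then 0 else
        Complex.exp (-Complex.I * (5 / 8 : ℝ) *
          (winding ((-Site.toComplex (stepDir ι)) :: (p.support.map Site.toComplex)) : ℝ)))

/-- The item's hypothesis (MIXED recursion: free step appended, kernel on the left). -/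
def IsMixedKernel (K : ℕ → Site 2 → Matrix (Fin 4) (Fin 4) ℂ) : Prop :=
  (∀ n z, z ∉ box 2 n → K n z = 0) ∧
  (∀ n, 1 ≤ n → ∀ z, mixedG n z =
    Matrix.of (fun ι κ => ∑ κ' : Fin 4, mixedG (n - 1) (z - stepDir κ) ι κ' * mixedT κ' κ) +
      ∑ m ∈ Finset.Icc 1 n, ∑ y ∈ box 2 m, K m y * mixedG (n - m) (z - y))

/-- The FIRST-STEP recursion (free step prepended, kernel on the left) — the repaired hypothesis; its unique
solution from length `1` on is `twistedLaceCoefficient (5/8)` (`twistedTwoPoint_succ`). -/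
def IsFirstStepKernel (K : ℕ → Site 2 → Matrix (Fin 4) (Fin 4) ℂ) : Prop :=
  (∀ n z, z ∉ box 2 n → K n z = 0) ∧
  (∀ n, 1 ≤ n → ∀ z, mixedG n z =
    Matrix.of (fun ι κ => ∑ lam : Fin 4, mixedT ι lam * mixedG (n - 1) (z - stepDir lam) lam κ) +
      ∑ m ∈ Finset.Icc 1 n, ∑ y ∈ box 2 m, K m y * mixedG (n - m) (z - y))

/-- `[Π^{5/8}_b, D](y)`: lace coefficient with the free step appended minus prepended (zero total mass). -/
def laceStepCommutator (b : ℕ) (y : Site 2) : Matrix (Fin 4) (Fin 4) ℂ :=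
  Matrix.of fun ι κ =>
    (∑ κ' : Fin 4, twistedLaceCoefficient (5 / 8) b (y - stepDir κ) ι κ' * twistedStepMatrix (5 / 8) κ' κ) -
      (∑ lam : Fin 4, twistedStepMatrix (5 / 8) ι lam * twistedLaceCoefficient (5 / 8) b (y - stepDir lam) lam κ)

/-- The conjugation correction `Corr_n(z) = Σ_{b<n} Σ_y G^{5/8}_{n-1-b}(z − y) · [Π^{5/8}_b, D](y)`. -/
def mixedCorrection (n : ℕ) (z : Site 2) : Matrix (Fin 4) (Fin 4) ℂ :=
  ∑ b ∈ Finset.range n, ∑ y ∈ box 2 (b + 1),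
    twistedTwoPoint (5 / 8) (n - 1 - b) (z - y) * laceStepCommutator b y

/-! ### 2. TRANSFER = REPAIR: the first-step (lace) form of the crux -/

/-- **Repaired crux, item shape** (`TwistedKernelTailIndexFS`): the crux verbatim except that the free term of
the recursion is the FIRST-STEP one `Σ_λ T(ι,λ) G_{n-1}(z − e_λ)(λ,κ)`; then the kernel is the lace
self-energy `Π^{5/8}` and the abscissa-`3/4` claim is the card's K1 tail. -/
def TwistedKernelTailIndexFS : Prop :=
  ∀ K : ℕ → Site 2 → Matrix (Fin 4) (Fin 4) ℂ, IsFirstStepKernel K →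
    (∀ s : ℝ, 0 ≤ s → s < 3 / 4 → Summable (moment K s)) ∧ (∀ s : ℝ, 3 / 4 < s → ¬ Summable (moment K s))

/-- **Repaired crux, clean form**: the twisted lace self-energy `Π^{5/8}` of the `ℤ²` SAW at `x_c` has
moment abscissa exactly `3/4` (tail index `11/4 = 4 − 2σ`). -/
def LaceTailIndex : Prop := HasMomentAbscissa (twistedLaceCoefficient (5 / 8)) (3 / 4)

/-- Provable now (M): item shape ↔ clean form (uniqueness of the first-step kernel + `twistedTwoPoint_succ` +
`mixedG = twistedTwoPoint (5/8)`). Signature only. -/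
theorem tailIndexFS_iff_lace : TwistedKernelTailIndexFS ↔ LaceTailIndex := by
  sorry

/-! ### 3. DECOMPOSITION of the crux AS TYPED (mixed convention) -/

/-- Piece 1 (algebra, provable now, L; = sibling stub): the mixed kernel is `Π^{5/8} − Corr` from length 1 on. -/
def MixedKernelIdentification : Prop :=
  ∀ K : ℕ → Site 2 → Matrix (Fin 4) (Fin 4) ℂ, IsMixedKernel K →
    ∀ n, 1 ≤ n → ∀ z, K n z = twistedLaceCoefficient (5 / 8) n z - mixedCorrection n z

/-- Piece 2 (= clause 1 of the REPAIRED crux; research-open): `Π^{5/8}` has finite `s`-moments, `0 ≤ s < 3/4`. -/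
def LaceMomentsUpper : Prop :=
  ∀ s : ℝ, 0 ≤ s → s < 3 / 4 → Summable (moment (twistedLaceCoefficient (5 / 8)) s)

/-- Piece 3 (the convention surcharge; BELIEVED FALSE — numerically abscissa(Corr) = 0, tail `|z|^{-2}`):
the conjugation correction has finite `s`-moments for `0 ≤ s < 3/4`. -/
def CorrMomentsUpper : Prop :=
  ∀ s : ℝ, 0 ≤ s → s < 3 / 4 → Summable (moment mixedCorrection s)

/-- Piece 4 (= clause 2 of the typed crux, believed true for the wrong reason): every mixed kernel has
infinite `s`-moments for `s > 3/4`. -/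
def KernelMomentsLower : Prop :=
  ∀ K : ℕ → Site 2 → Matrix (Fin 4) (Fin 4) ℂ, IsMixedKernel K → ∀ s : ℝ, 3 / 4 < s → ¬ Summable (moment K s)

/-- The glue of the typed split (provable now: `‖K_n‖ ≤ ‖Π_n‖ + ‖Corr_n‖` for `n ≥ 1`, support clause at
`n = 0`, comparison — the sibling composition `TwistedKernelSummable_of` with the weight `|z|^s`). Signature only. -/
theorem TwistedKernelTailIndex_of_subs :
    MixedKernelIdentification → LaceMomentsUpper → CorrMomentsUpper → KernelMomentsLower →
      Summit.CriticalPhenomena.SAWScalingLimit.Theses.SAWTwistedSelfEnergy.TwistedKernelTailIndex := by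
  sorry

/-! ### 4. STRENGTHEN: the `ε`-free two-sided tail law `S⁺` -/

/-- `S⁺`: exact pointwise power law for the `n`-summed absolute lace kernel, `c|z|^{-11/4} ≤ k(z) ≤ C|z|^{-11/4}`
for `|z| ≥ R` (implies `LaceTailIndex`; strictly stronger: no `ε`, pointwise lower bound in every direction). -/
def LaceTailPowerLaw : Prop :=
  (∀ z : Site 2, Summable (fun n : ℕ => xc ^ n * absM (twistedLaceCoefficient (5 / 8) n z))) ∧
  ∃ C c R : ℝ, 0 < c ∧ 0 < R ∧ ∀ z : Site 2, R ≤ ‖Site.toComplex z‖ →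
    c * ‖Site.toComplex z‖ ^ (-(11 / 4 : ℝ)) ≤ ∑' n : ℕ, xc ^ n * absM (twistedLaceCoefficient (5 / 8) n z) ∧
    ∑' n : ℕ, xc ^ n * absM (twistedLaceCoefficient (5 / 8) n z) ≤ C * ‖Site.toComplex z‖ ^ (-(11 / 4 : ℝ))

/-! ### 5. NEGATION: the typed obstruction (believed TRUE; it refutes the crux as typed) -/

/-- `CorrShellLower`: the conjugation correction has moment abscissa `0` — its dyadic shells carry
`n`-resolved absolute mass `≥ c_ε 2^{-εj}` (numerically the shell mass is ≍ 1: `k_Corr(z) ≍ |z|^{-2.0}`). -/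
def CorrShellLower : Prop :=
  ∀ ε : ℝ, 0 < ε → ∃ c : ℝ, 0 < c ∧ ∃ J : ℕ, ∀ j : ℕ, J ≤ j → ∃ N : ℕ,
    c * (2 : ℝ) ^ (-(ε * j)) ≤
      ∑ n ∈ Finset.range N, ∑ z ∈ annulus 2 (2 ^ j) (2 ^ (j + 1)), xc ^ n * absM (mixedCorrection n z)

/-- The refutation these pieces would give (provable now from the three hypotheses: on the shells `j ≥ J`,
`Σ x_c^n |z|^{1/2}‖K_n‖ ≥ 2^{j/2}(Corr-mass − Π-mass) → ∞`). Signature only. -/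
theorem not_TwistedKernelTailIndex_of :
    MixedKernelIdentification → LaceMomentsUpper → CorrShellLower →
      ¬ Summit.CriticalPhenomena.SAWScalingLimit.Theses.SAWTwistedSelfEnergy.TwistedKernelTailIndex := by
  sorry

/-! ### 6. Provable now: the typed crux contains the sibling crux (clause 1 at `s = 0`) -/

theorem tailIndex_imp_summable :
    Summit.CriticalPhenomena.SAWScalingLimit.Theses.SAWTwistedSelfEnergy.TwistedKernelTailIndex →
      Summit.CriticalPhenomena.SAWScalingLimit.Theses.SAWTwistedSelfEnergy.TwistedKernelSummable := by
  intro h K hK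
  have h0 := (h K hK).1 0 le_rfl (by norm_num)
  simpa only [Real.rpow_zero, mul_one] using h0

end Summit.CriticalPhenomena.SAWScalingLimit.Cruxes.TwistedKernelTailIndex.Strategist

end
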